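import Literature.NumberTheory.Automorphic.UnitaryGroupTruncatedKernelCellBound
import Literature.NumberTheory.Automorphic.RightModulusOneParameterProducts
import HarnessLib

/-!
# The oscillation estimate for Arthur's truncated kernel on `U(3)`: from the three-factor normal
# form of the conjugated fundamental domain to `‖k^T(g)‖ ≤ #R(g) · 3Lρ(g)`

Topic `NumberTheory/Automorphic`; namespace `Literature.NumberTheory.Automorphic.UnitaryGroup`.
Proof file: theorems only (no definition, no named fact, no instance, no `sorry`); imports = tree +
Mathlib. Setting: the quasi-split unitary group `U(J₃)` of the CM-type quadratic extension `E/F`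
(`quasiSplit F E c 3`), `N(𝔸_F) = adelicUnipotent F E c 3`, read on `GL₃(𝔸_E)` through
`adelicVal`; Arthur's truncated kernel `k^T = truncatedKernel ν 𝓕 T f` (Rogawski (1990), §2.2).

THE POINT. The cell bound ★ `norm_truncatedKernel_le_card_mul_of_forall_conj`
(`UnitaryGroupTruncatedKernelCellBound`) reduces the integrability of `k^T` high in the cusp to a
uniform right modulus of continuity `‖f x − f (x · g⁻¹ u g)‖ ≤ ε(g)` of the test function over the
conjugate `g⁻¹ 𝓕 g` of a fundamental domain `𝓕` of `N(F)`. The oscillation row (H5 of the T1-qs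
road to `TruncatedKernelIntegrable`) supplies `ε(g) = 3 · L · ρ(g)` from three inputs, which this
file takes as HYPOTHESES in the letters the three sub-rows deliver them:
* (H5c, the test function) a lift `φ` of `f` to `GL₃(𝔸_E)` (`f = φ ∘ adelicVal`), right invariant
  under a level `U ≤ GL₃(𝔸_E)` and Lipschitz along the archimedean one-parameter elements
  `(exp (tX), 1)`, `X` in a compact set `S` of directions: `‖φ (z · (exp (tX), 1)) − φ z‖ ≤ L|t|`
  (mean value theorem for archimedean-smooth compactly supported `φ`);
* (H5b, the geometry of `Ad(g⁻¹)` on the Heisenberg group) for `u` in the fundamental domain,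
  `adelicVal (g⁻¹ u g) = (exp (t₁X₁) exp (t₂X₂) exp (t₃X₃), 1) · w` with `Xᵢ ∈ S`, `|tᵢ| ≤ ρ(g)`,
  `w ∈ U` (three elementary unipotents, the archimedean contraction `ρ(g) ≍ H(g)⁻¹·…`, and the
  finite part absorbed in the level);
* (H5a, ★ `norm_sub_le_of_three_expGL` of `RightModulusOneParameterProducts`) the telescoping.
Conclusion (§1): `‖f x − f (x · g⁻¹ u g)‖ ≤ 3 L ρ(g)` for all `x` and all `u` in the domain; hence
(§2) `‖k^T(g)‖ ≤ #R(g) · 3 L ρ(g)` by the cell bound, in both the `R`-explicit and the packaged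
(`exists_finset_truncatedKernel`) forms. No choice of fundamental domain, torus coordinate or
level is made here: the consumer (the assembly of `TruncatedKernelIntegrable`) instantiates
`g := b k`, `ρ(g) := C · max ‖(d₀⁻¹dᵢ)_∞‖`, `𝓕 := 𝓕_m` and `U := K(𝔫)` with the H5b∕H5c files.

* §1 `forall_norm_sub_conj_le_of_threeFactor` (any seminormed target), `…_le_of_oneFactor`.
* §2 `norm_truncatedKernel_le_card_mul_of_threeFactor`, `exists_finset_norm_truncatedKernel_le_of_threeFactor`.

## References

* J. D. Rogawski, *Automorphic Representations of Unitary Groups in Three Variables*, Ann. of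
  Math. Studies 123 (1990), §2.2 (pp. 12–14) [Rogawski1990].
* S. Gelbart, *Automorphic forms on adele groups*, Ann. of Math. Studies 83 (1975), §9.B,
  (9.44)–(9.46) [Gelbart1975].
* J. Arthur, *A trace formula for reductive groups I*, Duke Math. J. 45 (1978), §7 (through the two
  expositions above).
-/

set_option autoImplicit false

noncomputable section

open MeasureTheory Measure NumberField NumberField.mixedEmbedding IsDedekindDomain Set
-- `open scoped Classical` is needed to see the Mathlib (normed ring) instances on `mixedSpace E` (note H5 of
-- `AdelicGLnGlue`)
open scoped NNReal ENNReal Pointwise MatrixGroups Classical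

namespace Literature.NumberTheory.Automorphic

namespace UnitaryGroup

variable {F E : Type} [Field F] [NumberField F] [Field E] [NumberField E] [Algebra F E]
  {c : E ≃ₐ[F] E}

/-! ## §1 The oscillation of `f` over `g⁻¹ Ω g` from the three-factor normal form -/

/-- **THE OSCILLATION BOUND.** If `f = φ ∘ adelicVal` with `φ` right invariant under `U ≤ GL₃(𝔸_E)`
and `L`-Lipschitz along the archimedean one-parameter elements `(exp (tX), 1)`, `X ∈ S`, and every
conjugate `g⁻¹ u g`, `u ∈ Ω`, reads on `GL₃(𝔸_E)` as `(exp (t₁X₁) exp (t₂X₂) exp (t₃X₃), 1) · w`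
with `Xᵢ ∈ S`, `|tᵢ| ≤ ρ`, `w ∈ U`, then `‖f x − f (x · g⁻¹ u g)‖ ≤ 3 · L · ρ` for all `x` and all
`u ∈ Ω`. [cite: Rogawski1990, §2.2 (p. 13)] -/
theorem forall_norm_sub_conj_le_of_threeFactor {V : Type*} [SeminormedAddCommGroup V]
    {f : (quasiSplit F E c 3).Adelic → V} {φ : GL (Fin 3) (AdeleRing (𝓞 E) E) → V}
    (hφ : ∀ y, f y = φ (adelicVal F E c 3 _ y))
    {U : Subgroup (GL (Fin 3) (AdeleRing (𝓞 E) E))} (hU : ∀ u ∈ U, ∀ z, φ (z * u) = φ z)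
    {S : Set (Matrix (Fin 3) (Fin 3) (mixedSpace E))} {L : ℝ} (hL0 : 0 ≤ L)
    (hL : ∀ z, ∀ X ∈ S, ∀ t : ℝ, ‖φ (z * GLn.ofInfinite 3 E (expGL (t • X))) - φ z‖ ≤ L * |t|)
    {g : (quasiSplit F E c 3).Adelic} {ρ : ℝ} {Ω : Set (adelicUnipotent F E c 3)}
    (hgeom : ∀ u ∈ Ω, ∃ (t₁ t₂ t₃ : ℝ) (X₁ X₂ X₃ : Matrix (Fin 3) (Fin 3) (mixedSpace E))
        (w : GL (Fin 3) (AdeleRing (𝓞 E) E)),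
      X₁ ∈ S ∧ X₂ ∈ S ∧ X₃ ∈ S ∧ w ∈ U ∧ |t₁| ≤ ρ ∧ |t₂| ≤ ρ ∧ |t₃| ≤ ρ ∧
      adelicVal F E c 3 _ (g⁻¹ * (u : (quasiSplit F E c 3).Adelic) * g) =
        GLn.ofInfinite 3 E (expGL (t₁ • X₁) * expGL (t₂ • X₂) * expGL (t₃ • X₃)) * w) :
    ∀ x : (quasiSplit F E c 3).Adelic, ∀ u ∈ Ω,
      ‖f x - f (x * (g⁻¹ * (u : (quasiSplit F E c 3).Adelic) * g))‖ ≤ 3 * L * ρ := by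
  intro x u hu
  obtain ⟨t₁, t₂, t₃, X₁, X₂, X₃, w, hX₁, hX₂, hX₃, hw, h₁, h₂, h₃, hval⟩ := hgeom u hu
  rw [hφ, hφ, map_mul, hval, norm_sub_rev]
  exact norm_sub_le_of_three_expGL φ hU hL0 hL h₁ h₂ h₃ hX₁ hX₂ hX₃ hw _

/-- **One factor** (the degenerate form, e.g. for a commutative unipotent radical): if every
conjugate reads `(exp (tX), 1) · w`, `X ∈ S`, `|t| ≤ ρ`, `w ∈ U`, then `‖f x − f (x · g⁻¹ u g)‖ ≤ L · ρ`.
[cite: Rogawski1990, §2.2 (p. 13)] -/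
theorem forall_norm_sub_conj_le_of_oneFactor {V : Type*} [SeminormedAddCommGroup V]
    {f : (quasiSplit F E c 3).Adelic → V} {φ : GL (Fin 3) (AdeleRing (𝓞 E) E) → V}
    (hφ : ∀ y, f y = φ (adelicVal F E c 3 _ y))
    {U : Subgroup (GL (Fin 3) (AdeleRing (𝓞 E) E))} (hU : ∀ u ∈ U, ∀ z, φ (z * u) = φ z)
    {S : Set (Matrix (Fin 3) (Fin 3) (mixedSpace E))} {L : ℝ} (hL0 : 0 ≤ L)
    (hL : ∀ z, ∀ X ∈ S, ∀ t : ℝ, ‖φ (z * GLn.ofInfinite 3 E (expGL (t • X))) - φ z‖ ≤ L * |t|)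
    {g : (quasiSplit F E c 3).Adelic} {ρ : ℝ} {Ω : Set (adelicUnipotent F E c 3)}
    (hgeom : ∀ u ∈ Ω, ∃ (t : ℝ) (X : Matrix (Fin 3) (Fin 3) (mixedSpace E))
        (w : GL (Fin 3) (AdeleRing (𝓞 E) E)), X ∈ S ∧ w ∈ U ∧ |t| ≤ ρ ∧
      adelicVal F E c 3 _ (g⁻¹ * (u : (quasiSplit F E c 3).Adelic) * g) =
        GLn.ofInfinite 3 E (expGL (t • X)) * w) :
    ∀ x : (quasiSplit F E c 3).Adelic, ∀ u ∈ Ω,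
      ‖f x - f (x * (g⁻¹ * (u : (quasiSplit F E c 3).Adelic) * g))‖ ≤ L * ρ := by
  intro x u hu
  obtain ⟨t, X, w, hX, hw, ht, hval⟩ := hgeom u hu
  rw [hφ, hφ, map_mul, hval, norm_sub_rev]
  exact norm_sub_le_of_expGL φ hU hL0 hL ht hX hw _

/-! ## §2 Plugging into the cell bound: `‖k^T(g)‖ ≤ #R(g) · 3Lρ(g)` -/

variable [MeasurableSpace (adelicUnipotent F E c 3)] [BorelSpace (adelicUnipotent F E c 3)]

/-- **THE TRUNCATED KERNEL IS SMALL HIGH IN THE CUSP, `R`-explicit form**: under the hypotheses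
of the cell bound ★ `norm_truncatedKernel_le_card_mul_of_forall_conj` (`ν` Haar on `N(𝔸_F)`, `𝓕`
a fundamental domain of `N(F)` inside a compact set, `f ∈ C_c`, `1 ≤ T < H(g)`,
`K(g, g) = Σ_{β ∈ B(F)} f(g⁻¹βg)`, `R` carrying all the terms) and the three-factor normal form of
`g⁻¹ 𝓕 g` (§1), `‖k^T(g)‖ ≤ #R · (3 · L · ρ)`. [cite: Rogawski1990, §2.2 (p. 13)] -/
theorem norm_truncatedKernel_le_card_mul_of_threeFactor (ν : Measure (adelicUnipotent F E c 3))
    [ν.IsHaarMeasure] {𝓕 Uc : Set (adelicUnipotent F E c 3)}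
    (h𝓕 : IsFundamentalDomain (rationalUnipotent F E c 3) 𝓕 ν) (hUc : IsCompact Uc) (h𝓕U : 𝓕 ⊆ Uc)
    {f : (quasiSplit F E c 3).Adelic → ℂ} (hfc : Continuous f) (hf : HasCompactSupport f)
    {T : ℝ≥0} (hT : 1 ≤ T) {g : (quasiSplit F E c 3).Adelic} (hg : T < borelHeight g)
    (hK : kernel f g g = borelSum f g g) (R : Finset (arithmeticBorel F E c 3))
    (hR₁ : ∀ β ∉ R,
      f (g⁻¹ * (((β : (quasiSplit F E c 3).arithmeticSubgroup)) : (quasiSplit F E c 3).Adelic) * g) = 0)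
    (hR₂ : ∀ β ∉ R, ∀ u ∈ 𝓕,
      f (g⁻¹ * (((β : (quasiSplit F E c 3).arithmeticSubgroup)) : (quasiSplit F E c 3).Adelic) *
        ((u : (quasiSplit F E c 3).Adelic) * g)) = 0)
    {φ : GL (Fin 3) (AdeleRing (𝓞 E) E) → ℂ} (hφ : ∀ y, f y = φ (adelicVal F E c 3 _ y))
    {U : Subgroup (GL (Fin 3) (AdeleRing (𝓞 E) E))} (hU : ∀ u ∈ U, ∀ z, φ (z * u) = φ z)
    {S : Set (Matrix (Fin 3) (Fin 3) (mixedSpace E))} {L : ℝ} (hL0 : 0 ≤ L)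
    (hL : ∀ z, ∀ X ∈ S, ∀ t : ℝ, ‖φ (z * GLn.ofInfinite 3 E (expGL (t • X))) - φ z‖ ≤ L * |t|)
    {ρ : ℝ}
    (hgeom : ∀ u ∈ 𝓕, ∃ (t₁ t₂ t₃ : ℝ) (X₁ X₂ X₃ : Matrix (Fin 3) (Fin 3) (mixedSpace E))
        (w : GL (Fin 3) (AdeleRing (𝓞 E) E)),
      X₁ ∈ S ∧ X₂ ∈ S ∧ X₃ ∈ S ∧ w ∈ U ∧ |t₁| ≤ ρ ∧ |t₂| ≤ ρ ∧ |t₃| ≤ ρ ∧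
      adelicVal F E c 3 _ (g⁻¹ * (u : (quasiSplit F E c 3).Adelic) * g) =
        GLn.ofInfinite 3 E (expGL (t₁ • X₁) * expGL (t₂ • X₂) * expGL (t₃ • X₃)) * w) :
    ‖truncatedKernel ν 𝓕 T f g‖ ≤ R.card * (3 * L * ρ) :=
  norm_truncatedKernel_le_card_mul_of_forall_conj ν h𝓕 hUc h𝓕U hfc hf hT hg hK R hR₁ hR₂
    (forall_norm_sub_conj_le_of_threeFactor hφ hU hL0 hL hgeom)

/-- **THE TRUNCATED KERNEL IS SMALL HIGH IN THE CUSP, packaged form**: with `R(g)` the finite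
set of ★ `exists_finset_truncatedKernel` (the `β ∈ B(F)` with `g⁻¹ β (y g) ∈ supp f` for some
`y ∈ {1} ∪ Uc`), `‖k^T(g)‖ ≤ #R(g) · (3 · L · ρ)`. [cite: Rogawski1990, §2.2 (p. 13)] -/
theorem exists_finset_norm_truncatedKernel_le_of_threeFactor (ν : Measure (adelicUnipotent F E c 3))
    [ν.IsHaarMeasure] {𝓕 Uc : Set (adelicUnipotent F E c 3)}
    (h𝓕 : IsFundamentalDomain (rationalUnipotent F E c 3) 𝓕 ν) (hUc : IsCompact Uc) (h𝓕U : 𝓕 ⊆ Uc)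
    {f : (quasiSplit F E c 3).Adelic → ℂ} (hfc : Continuous f) (hf : HasCompactSupport f)
    {T : ℝ≥0} (hT : 1 ≤ T) {g : (quasiSplit F E c 3).Adelic} (hg : T < borelHeight g)
    (hK : kernel f g g = borelSum f g g)
    {φ : GL (Fin 3) (AdeleRing (𝓞 E) E) → ℂ} (hφ : ∀ y, f y = φ (adelicVal F E c 3 _ y))
    {U : Subgroup (GL (Fin 3) (AdeleRing (𝓞 E) E))} (hU : ∀ u ∈ U, ∀ z, φ (z * u) = φ z)
    {S : Set (Matrix (Fin 3) (Fin 3) (mixedSpace E))} {L : ℝ} (hL0 : 0 ≤ L)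
    (hL : ∀ z, ∀ X ∈ S, ∀ t : ℝ, ‖φ (z * GLn.ofInfinite 3 E (expGL (t • X))) - φ z‖ ≤ L * |t|)
    {ρ : ℝ}
    (hgeom : ∀ u ∈ 𝓕, ∃ (t₁ t₂ t₃ : ℝ) (X₁ X₂ X₃ : Matrix (Fin 3) (Fin 3) (mixedSpace E))
        (w : GL (Fin 3) (AdeleRing (𝓞 E) E)),
      X₁ ∈ S ∧ X₂ ∈ S ∧ X₃ ∈ S ∧ w ∈ U ∧ |t₁| ≤ ρ ∧ |t₂| ≤ ρ ∧ |t₃| ≤ ρ ∧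
      adelicVal F E c 3 _ (g⁻¹ * (u : (quasiSplit F E c 3).Adelic) * g) =
        GLn.ofInfinite 3 E (expGL (t₁ • X₁) * expGL (t₂ • X₂) * expGL (t₃ • X₃)) * w) :
    ∃ R : Finset (arithmeticBorel F E c 3),
      (∀ β ∈ R, ∃ y ∈ insert (1 : (quasiSplit F E c 3).Adelic)
          ((fun u : adelicUnipotent F E c 3 => (u : (quasiSplit F E c 3).Adelic)) '' Uc),
        g⁻¹ * (((β : (quasiSplit F E c 3).arithmeticSubgroup)) : (quasiSplit F E c 3).Adelic) * (y * g)
          ∈ tsupport f) ∧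
      ‖truncatedKernel ν 𝓕 T f g‖ ≤ R.card * (3 * L * ρ) := by
  obtain ⟨R, hR, -, hbound⟩ := exists_finset_truncatedKernel ν h𝓕 hUc h𝓕U hfc hf hT hg hK
  exact ⟨R, hR, hbound _ (forall_norm_sub_conj_le_of_threeFactor hφ hU hL0 hL hgeom)⟩

end UnitaryGroup

end Literature.NumberTheory.Automorphic

end
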